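import Summits.HodgeConjecture.HodgeConjecture.Theses.NikulinTwinTransport
import Literature.AlgebraicGeometry.Surfaces.K3ComplexMultiplication
import Literature.AlgebraicGeometry.HodgeTheory.GlobalInvariantCycles

/-!
# Sketch — crux-ideate round 1, ideator 1, crux `HodgeSimilitudeAlgebraic` (stmt-HodgeConjecture-13676)

First lemmas of the three idea cards (`Ideas/*.md`), stated over existing declarations only.
Nothing here is proved; the point is that the statements elaborate.

* Card A `cm-norm-anchors`: `CMNormAnchor r` and `FirstLemmaA`.
* Card B `semiregular-twin-hecke-vhc`: `openSpreading_algebraicLocus` (the globalisation step).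
* Card C `kummer-bkr-quaternion-carrier`: `KummerCodeSimilitude` (the lattice completion, decidable).
-/

noncomputable section

open CategoryTheory MonoidalCategory
open Literature.AlgebraicGeometry
open Literature.AlgebraicGeometry.HodgeTheory
open Literature.AlgebraicGeometry.Surfaces
open Literature.AlgebraicTopology.SingularHomology
open Summit.HodgeConjecture.HodgeConjecture.Theses.NikulinTwinTransport

namespace Summit.HodgeConjecture.HodgeConjecture.Cruxes.HodgeSimilitudeAlgebraic.Sketch

/-! ## Card A — CM-norm anchors -/

/-- `S` carries a rational Hodge SELF-similitude of multiplier `r`: a `ℂ`-linear endomorphism of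
`H²(S(ℂ);ℂ)` preserving rational classes and Hodge types with `(e x . e y) = r (x . y)`.
For a K3 surface with CM field `E = End_Hdg(T(S)_ℚ)` this holds iff `r ∈ N_{E/E₀}(E^×)`
(take `e = γ ⊕ ν`, `γ γ̄ = r`, `ν` an `r`-similitude of `NS_ℚ`, which exists by Witt cancellation). -/
def HasHodgeSelfSimilitude (r : ℚ) (S : Motives.SchemeOver ℂ) : Prop :=
  ∃ e : complexBetti S (2 * 1) →ₗ[ℂ] complexBetti S (2 * 1),
    Function.Bijective e ∧
    (∀ x, IsRationalClass x → IsRationalClass (e x)) ∧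
    (∀ (i j : ℕ) x, IsOfHodgeType 2 S (2 * 1) i j x → IsOfHodgeType 2 S (2 * 1) i j (e x)) ∧
    ∀ x y : complexBetti S (2 * 1),
      cupProduct (rfl : 2 * 1 + 2 * 1 = 2 * 2) (e x) (e y) =
        (r : ℂ) • cupProduct (rfl : 2 * 1 + 2 * 1 = 2 * 2) x y

/-- The crux at a fixed multiplier `r` and a fixed TARGET K3 surface `S`: every rational,
type-preserving `r`-similitude `ψ : H²(S'(ℂ);ℂ) → H²(S(ℂ);ℂ)` from any projective K3 surface `S'`
is induced by an algebraic class on `S × S'` (verbatim the body of `HodgeSimilitudeAlgebraic`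
with `r`, `S` frozen). -/
def SimAlgInto (r : ℚ) (S : Motives.SchemeOver ℂ) : Prop :=
  ∀ (μ : OrientationFamily), μ.HasPoincareDuality →
  ∀ (S' : Motives.SchemeOver ℂ) (hS : IsK3Surface S) (hS' : IsK3Surface S')
    (p : complexBetti S (2 * 2)) (p' : complexBetti S' (2 * 2)),
    (IsIntegralClass p ∧ ∀ q : complexBetti S (2 * 2), IsIntegralClass q → ∃ n : ℤ, q = n • p) →
    (IsIntegralClass p' ∧ ∀ q : complexBetti S' (2 * 2), IsIntegralClass q → ∃ n : ℤ, q = n • p') →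
  ∀ (ψ : complexBetti S' (2 * 1) →ₗ[ℂ] complexBetti S (2 * 1)),
    (∀ x, IsRationalClass x → IsRationalClass (ψ x)) →
    (∀ (i j : ℕ) x, IsOfHodgeType 2 S' (2 * 1) i j x → IsOfHodgeType 2 S (2 * 1) i j (ψ x)) →
    (∀ (x y : complexBetti S' (2 * 1)) (a : ℂ),
      cupProduct (rfl : 2 * 1 + 2 * 1 = 2 * 2) x y = a • p' →
      cupProduct (rfl : 2 * 1 + 2 * 1 = 2 * 2) (ψ x) (ψ y) = ((r : ℂ) * a) • p) →
    ∃ γ ∈ algebraicClasses (S ⊗ S') 2, ∀ x : complexBetti S' (2 * 1),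
      ψ x = complexGysin μ (Motives.IsSmoothProjective.tensor_holds hS.1 hS'.1) hS.1
        (SemiCartesianMonoidalCategory.fst S S') (rfl : 2 * 1 + 2 * 2 + 2 * 2 = 2 * 1 + 2 * (2 + 2))
        (cupProduct (rfl : 2 * 1 + 2 * 2 = 2 * 1 + 2 * 2)
          (complexBetti.map (SemiCartesianMonoidalCategory.snd S S') (2 * 1) x) γ)

/-- **CM-norm anchor** (card A): a projective K3 surface with complex multiplication carrying a
rational Hodge self-similitude of multiplier `r` (i.e. `r` is a norm from its CM field) is a
proved instance of the crux: every rational Hodge `r`-similitude into it is algebraic. -/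
def CMNormAnchor (r : ℚ) : Prop :=
  ∀ S : Motives.SchemeOver ℂ, IsK3Surface S → HasComplexMultiplication S →
    HasHodgeSelfSimilitude r S → SimAlgInto r S

/-- **First lemma of card A.** From the CM-square corollary (Buskin 2019 / Huybrechts 2019 Cor. 0.4
(ii); Ramón-Marí 2008 Thm 3.3) and Buskin's isometry theorem (route item `HodgeIsometryAlgebraic`):
`e⁻¹ ∘ ψ` is a rational Hodge isometry, hence algebraic, and `graph(e)` is a Hodge class on `S × S`,
hence algebraic; compose. (Uses composition of algebraic correspondences — formal debt shared with
`RealMultiplicationGlue`.) -/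
def FirstLemmaA : Prop :=
  Buskin2019_hodgeConjectureFor_square_of_CM → HodgeIsometryAlgebraic →
    ∀ r : ℚ, 0 < r → CMNormAnchor r

/-! ## Card B — semiregular deformation along the twin Hecke correspondence: globalisation step -/

/-- **Open spreading of the algebraic locus** (card B, globalisation): over a smooth connected
quasi-projective base, a flat rational section of `R^{2p} f_* ℂ` that is ALGEBRAIC on the fibres over
a non-empty analytically open set of the base is algebraic on every fibre (relative Chow components
are countably many and proper over the base; a flat class lying in the span of flat cycle classes is
an open-and-closed condition on each component; Baire). This is the step that turns the local output
of Buchweitz–Flenner–Pridham semiregular deformation into the crux on a whole Hecke component. -/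
def openSpreading_algebraicLocus : Prop :=
  ∀ (𝒳 S : Motives.SchemeOver ℂ) (f : 𝒳 ⟶ S) (n p : ℕ),
    Motives.IsSmoothProjectiveFamily f n → IsQuasiProjectiveOver S → AlgebraicGeometry.Smooth S.hom →
    ConnectedSpace (Motives.ComplexPoints S) →
    ∀ (σ : Motives.ComplexPoints S → FiberClass f (2 * p)),
      Continuous σ → (∀ s, (σ s).pt = s) → (∀ s, IsRationalClass (σ s).cls) →
      (∃ U : Set (Motives.ComplexPoints S), IsOpen U ∧ U.Nonempty ∧
          ∀ s ∈ U, (σ s).cls ∈ algebraicClasses (Motives.fiberOver f (σ s).pt) p) →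
        ∀ s : Motives.ComplexPoints S, (σ s).cls ∈ algebraicClasses (Motives.fiberOver f (σ s).pt) p

/-! ## Card C — Kummer / BKR carrier: the lattice completion -/

/-- The bits of `v : Fin 16` read as a point of `𝔽₂⁴`. -/
def bit (k : ℕ) (v : Fin 16) : ZMod 2 := ((v.val / 2 ^ k) % 2 : ℕ)

/-- The first-order Reed–Muller code `RM(1,4) ⊂ 𝔽₂¹⁶`: affine-linear functions on `𝔽₂⁴`. Its
preimage in `(½ℤ)¹⁶` under `x ↦ 2x mod 2` is the Kummer overlattice `K ⊃ ⊕ ℤ E_a` generated by the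
sixteen nodal classes of a Kummer surface and the half-sums over affine hyperplanes (Nikulin). -/
def rm14 : Submodule (ZMod 2) (Fin 16 → ZMod 2) :=
  Submodule.span (ZMod 2) {fun _ => 1, bit 0, bit 1, bit 2, bit 3}

/-- **Kummer code similitude** (first lemma of card C, decidable per `p`): for every prime `p` there is
an integral `p`-similitude `M` of `ℤ¹⁶` (`Mᵀ M = p·1`; four diagonal blocks of left multiplication
by a Lipschitz quaternion of norm `p`, Lagrange) whose reduction mod 2 preserves `RM(1,4)` — hence an
integral `p`-similitude of `⟨-2⟩¹⁶` preserving the Kummer lattice `K`, completing `f^*` of a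
degree-`p` isogeny of abelian surfaces to an integral Hodge `p`-similitude of the whole
`H²(Km A', ℤ) → H²(Km A, ℤ)[1/2]`. -/
def KummerCodeSimilitude : Prop :=
  ∀ p : ℕ, p.Prime →
    ∃ M : Matrix (Fin 16) (Fin 16) ℤ,
      M.transpose * M = (p : ℤ) • (1 : Matrix (Fin 16) (Fin 16) ℤ) ∧
      ∀ c ∈ rm14, (M.map (Int.cast : ℤ → ZMod 2)).mulVec c ∈ rm14

/-! ## Sanity: the crux at a CM-norm target is an instance of `SimAlgInto` -/

/-- The crux body at fixed `r`, unfolded target-first, is `∀ S, SimAlgInto r S` up to reordering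
binders (statement only; kept as documentation of how card A plugs into the crux). -/
def CruxAt (r : ℚ) : Prop := ∀ S : Motives.SchemeOver ℂ, IsK3Surface S → SimAlgInto r S

end Summit.HodgeConjecture.HodgeConjecture.Cruxes.HodgeSimilitudeAlgebraic.Sketch

end
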